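import Literature.Computability.AlgebraicComplexity.ChowPointLabelMajorCertificates
import HarnessLib

/-!
# Label-major evaluation of tableau highest-weight vectors with COLUMN SYMMETRISATION

Glue file (cell `val-lit`, DIP20 lane; honest framing below), an extension of the Lean checker of
tableau highest-weight-vector certificates: the label-major programme `evalA` / `evalT`
(`TableauEvalLabelMajor.lean`, pub-gct; table-driven form `ChowPointLabelMajorCertificates.lean`,
val-lit-t15 g4) carries as its state the list of unused alternator variables PER COLUMN, the columns
distinguishable by their position. Columns with the SAME label list are interchangeable — the value of
the remaining labels on a list of residual columns does not depend on the order of the columns — so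
the states may be taken up to permutations inside every block of equal columns. For the shapes of
Dörfler–Ikenmeyer–Panova's Prop. 5.1, `Ch_4^7` half (arXiv:1901.04576, Prop. 18 of the e-print: the
948 generators of Prop. 7.1), whose tall columns carry few distinct label lists (e.g. `(10,6,6,6)`,
`d = 4`: six equal full columns `[0,1,2,3]`), this divides the layers by up to the factorials of the
block sizes (`(10,6,6,6)` at a sparse point: `1.1·10⁶ → 1.2·10⁴` transitions, §6), which is what
brings those rows inside one kernel evaluation.

Contents (all [folklore] bookkeeping; the mathematics is the permutation invariance of the
column-bijection sum, DIP §5):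
* §1 **`specL_reindex` / `specL_perm`** — the label-major specification `specL S U cs`
  (`TableauEvalLabelWalk.lean`) is invariant under any reindexing / permutation of the column list,
  for an entry function `S` that is blind to the order of a word (proved one label at a time from
  pub-gct's `sum_walkL`: a reindexing of the columns is a change of the choice-tuple variable);
* §2 the canonical form `canonSt cols st` of a state (insertion sort of the variable lists inside
  the blocks of equal adjacent columns; structural recursion only, kernel-evaluable) and
  `resid_canonSt_perm`: its residual columns are a permutation of the residual columns;
* §3 the symmetrised programme **`stepS` / `layersS`** (= the tree's `stepA`, then canonical states,
  re-sorted and merged by the tree's `msortK` / `compressA`) with **`layerSpec_stepS`** and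
  **`layerSum_layersS`** — the meaning `layerSpec` (`TableauEvalLabelMajorImpl.lean` §4) is preserved,
  by `layerSpec_stepA` and §1–§2;
* §4 the table-driven evaluator **`evalTS`** (t15's `tableTrie`), the total description of the table
  trie's lookup `find_tableTrie_total` (content-blind: `find_tableTrie_perm`), **`evalTS_eq_evalT`**
  (column-strict networks) and the chunking identity `evalTS_eq_layerSum_split`;
* §5 **`coordRingMultiplicity_chowSet_pos_of_tableCertificateS`** — t15's one-entry certificate
  theorem `coordRingMultiplicity_chowSet_pos_of_tableCertificate` with `evalTS` in place of `evalT`;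
* §6 kernel sanity values (`evalTS = evalT` on the toy network; the `(10,6,6,6)` residue row).

Definitions here are evaluator plumbing only (no statement of record is touched, no named fact).
HONEST FRAMING: certificate-checking plumbing for DIP's TOY MODEL `Pow ⊄ Ch` (Chow variety versus
power sums); nothing here bears on permanent versus determinant; VP ≠ VNP is not proved.

## References
* [DorflerIkenmeyerPanova2020] J. Dörfler, C. Ikenmeyer, G. Panova, *On geometric complexity theory:
  multiplicity obstructions are stronger than occurrence obstructions*, SIAM J. Appl. Algebra Geom. 4
  (2020) = arXiv:1901.04576, §5 (proof of Prop. 5.1 = Prop. 18 of the e-print, the proper-placement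
  sum and its transfer-matrix organisation, arXiv pp. 12–13).

## Mathlib and tree
Mathlib: `Fintype.sum_equiv`, `Fintype.prod_equiv`, `finSuccEquiv`, `Equiv.swap`, `List.Perm`,
`List.perm_of_nodup_nodup_toFinset_eq`, `List.Perm.count_eq`, `List.map_fst_zip`.
Tree: `specL`, `walkL`, `Column.active` (`TableauEvalLabelWalk`); `sum_walkL`, `wordB`, `epsK`
(`TableauEvalLabelMajorSpec`); `nchB`, `redB`, `preB` (`TableauEvalRowPeel`); `stepA`, `layersA`,
`layerSum`, `keyOf`, `msortK`, `compressA`, `PTrie.find`, `Network.initLayer`, `Network.varBound`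
(`TableauEvalLabelMajor`); `layerSpec`, `layerSpec_stepA`, `layerSum_layersA`, `sum_compressA`,
`msortK_perm`, `length_of_mem_stepA`, `resid`, `pairwise_of_columnStrict`, `PTrie.find_cons`,
`PTrie.find_nil`, `PTrie.find_empty`, `PTrie.isEmpty_iff` (`TableauEvalLabelMajorImpl`); `tableTrie`,
`lookupC`, `counts`, `checkTable`, `chowPoint`, `evalT`, `coordRingMultiplicity_chowSet_pos_of_tableCertificate`
(`ChowPointLabelMajorCertificates`, val-lit-t15 g4); `chowSet`, `coordRingMultiplicity`
(`DIP20MultiplicityObstructions`).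

Provenance: val-lit cell, literature-prover val-lit-t07 g4 (DIP20 Prop. 5.1, `Ch_4^7` half; design
note `HOME/bip/NOTE-t07g4-column-symmetrised-evaluator.md`).
-/

namespace Literature.Computability.AlgebraicComplexity

namespace TableauEval

open Equiv

/-! ## §1 The specification is invariant under reindexing the columns -/

section Reindex

variable {R : Type*} [CommRing R]

/-- A list enumerated along an equivalence of `Fin` types is a permutation of the plain
enumeration. [folklore] -/
private theorem perm_ofFn_comp_equiv {α : Type*} {m n : ℕ} (e : Fin m ≃ Fin n) (g : Fin n → α) :
    (List.ofFn (g ∘ e)).Perm (List.ofFn g) := by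
  have h1 : (List.ofFn (fun i => e i)).Perm (List.finRange n) := by
    refine List.perm_of_nodup_nodup_toFinset_eq (List.nodup_ofFn.mpr e.injective)
      (List.nodup_finRange n) ?_
    ext x; simp only [List.mem_toFinset, List.mem_ofFn, List.mem_finRange, iff_true]
    exact ⟨e.symm x, e.apply_symm_apply x⟩
  have h2 := h1.map g
  rw [List.map_ofFn, ← List.ofFn_eq_map] at h2
  exact h2

/-- **Reindexing the (residual) columns along any bijection leaves `specL` unchanged**, for an
entry function that only sees the content of a word. [cite: DorflerIkenmeyerPanova2020, §5 (proof of Prop. 5.1, arXiv pp. 12–13)] -/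
theorem specL_reindex (S : List ℕ → R) (hS : ∀ w w' : List ℕ, w.Perm w' → S w = S w') :
    ∀ (U : List ℕ) (cs cs' : List Column) (e : Fin cs'.length ≃ Fin cs.length),
      (∀ i, cs'.get i = cs.get (e i)) → specL S U cs' = specL S U cs
  | [], cs, cs', e, h => by simp [specL]
  | u :: us, cs, cs', e, h => by
    -- abbreviations
    set act : Fin cs.length → Bool := fun i => (cs.get i).active u with hact
    set act' : Fin cs'.length → Bool := fun i => (cs'.get i).active u with hact'
    have hae : ∀ i, act' i = act (e i) := fun i => by simp only [hact, hact', h i]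
    -- both sides as sums over choice tuples
    have A := sum_walkL u cs act (fun _ => rfl) (fun s w res => s * S w * specL S us res)
    have B := sum_walkL u cs' act' (fun _ => rfl) (fun s w res => s * S w * specL S us res)
    beta_reduce at A B
    rw [specL, specL, A, B]
    have hN : ∀ i, nchB (act (e i)) (cs.get (e i)) = nchB (act' i) (cs'.get i) := fun i => by
      rw [hae, h i]
    have hN' : ∀ a, nchB (act' (e.symm a)) (cs'.get (e.symm a)) = nchB (act a) (cs.get a) := fun a => by
      rw [← hN, e.apply_symm_apply]
    have key : ∀ (js : (a : Fin cs.length) → Fin (nchB (act a) (cs.get a))) {a b : Fin cs.length},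
        a = b → ((js a : ℕ)) = js b := by intro js a b hab; subst hab; rfl
    have key' : ∀ (js : (i : Fin cs'.length) → Fin (nchB (act' i) (cs'.get i))) {a b : Fin cs'.length},
        a = b → ((js a : ℕ)) = js b := by intro js a b hab; subst hab; rfl
    -- the equivalence of choice-tuple types
    let Eq1 : ((a : Fin cs.length) → Fin (nchB (act a) (cs.get a))) ≃
        ((i : Fin cs'.length) → Fin (nchB (act' i) (cs'.get i))) :=
      { toFun := fun js i => Fin.cast (hN i) (js (e i))
        invFun := fun js' a => Fin.cast (hN' a) (js' (e.symm a))
        left_inv := fun js => by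
          funext a; apply Fin.ext; simp only [Fin.val_cast]; exact key js (e.apply_symm_apply a)
        right_inv := fun js' => by
          funext i; apply Fin.ext; simp only [Fin.val_cast]; exact key' js' (e.symm_apply_apply i) }
    refine (Fintype.sum_equiv Eq1 _ _ fun js => ?_).symm
    -- termwise: sign, word, residual columns
    have hv : ∀ i, ((Eq1 js i : ℕ)) = js (e i) := fun i => by simp [Eq1]
    congr 1
    congr 1
    · -- ∏ epsK
      refine (Fintype.prod_equiv e (fun i => epsK R (act' i) (Eq1 js i)) (fun a => epsK R (act a) (js a))
        fun i => ?_).symm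
      rw [hv i, hae i]
    · -- S of the word
      apply hS
      unfold wordB
      have hfun : (fun i => preB (act' i) (cs'.get i) (Eq1 js i)) =
          (fun a => preB (act a) (cs.get a) (js a)) ∘ e := by
        funext i; simp only [Function.comp_apply, hv i, hae i, h i]
      rw [hfun]
      exact (perm_ofFn_comp_equiv e _).flatten.symm
    · -- residual columns, by induction
      set r : Fin cs.length → Column := fun a => redB (act a) (cs.get a) (js a) with hr
      set r' : Fin cs'.length → Column := fun i => redB (act' i) (cs'.get i) (Eq1 js i) with hr'
      have hl : (List.ofFn r).length = cs.length := List.length_ofFn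
      have hl' : (List.ofFn r').length = cs'.length := List.length_ofFn
      let e' : Fin (List.ofFn r').length ≃ Fin (List.ofFn r).length :=
        (Fin.castOrderIso hl').toEquiv.trans (e.trans (Fin.castOrderIso hl.symm).toEquiv)
      refine (specL_reindex S hS us (List.ofFn r) (List.ofFn r') e' fun i => ?_).symm
      rw [List.get_ofFn, List.get_ofFn]
      have he' : ∀ i, ((e' i : Fin (List.ofFn r).length) : ℕ) = (e (Fin.cast hl' i) : ℕ) := fun i => rfl
      have hc : Fin.cast hl (e' i) = e (Fin.cast hl' i) := Fin.ext (he' i)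
      rw [hc]
      show redB (act' (Fin.cast hl' i)) (cs'.get (Fin.cast hl' i)) (Eq1 js (Fin.cast hl' i) : ℕ) =
        redB (act (e (Fin.cast hl' i))) (cs.get (e (Fin.cast hl' i))) (js (e (Fin.cast hl' i)) : ℕ)
      rw [hv, hae, h]


/-- A permutation of a list is a reindexing along a bijection of positions. [folklore] -/
private theorem exists_equiv_get_of_perm {α : Type*} {l₁ l₂ : List α} (h : l₁.Perm l₂) :
    ∃ e : Fin l₁.length ≃ Fin l₂.length, ∀ i, l₁.get i = l₂.get (e i) := by
  induction h with
  | nil => exact ⟨Equiv.refl _, fun i => i.elim0⟩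
  | cons x _ ih =>
    obtain ⟨e, he⟩ := ih
    refine ⟨(finSuccEquiv _).trans ((Equiv.optionCongr e).trans (finSuccEquiv _).symm), fun i => ?_⟩
    refine Fin.cases ?_ (fun j => ?_) i
    · simp [finSuccEquiv_zero, finSuccEquiv_symm_none]
    · simp only [Equiv.trans_apply, finSuccEquiv_succ, Equiv.optionCongr_apply, Option.map_some,
        finSuccEquiv_symm_some, List.get_cons_succ']
      exact he j
  | swap x y l =>
    refine ⟨Equiv.swap ⟨0, by simp⟩ ⟨1, by simp⟩, fun i => ?_⟩
    match i with
    | ⟨0, _⟩ => simp [Equiv.swap_apply_left]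
    | ⟨1, _⟩ => simp [Equiv.swap_apply_right]
    | ⟨k + 2, hk⟩ =>
      rw [Equiv.swap_apply_of_ne_of_ne (by simp [Fin.ext_iff]) (by simp [Fin.ext_iff])]
      rfl
  | trans _ _ ih₁ ih₂ =>
    obtain ⟨e₁, h₁⟩ := ih₁
    obtain ⟨e₂, h₂⟩ := ih₂
    exact ⟨e₁.trans e₂, fun i => by rw [h₁, h₂]; rfl⟩

/-- **`specL` is invariant under permuting the (residual) columns**, for an entry function that only
sees the content of a word. [cite: DorflerIkenmeyerPanova2020, §5 (proof of Prop. 5.1, arXiv pp. 12–13)] -/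
theorem specL_perm (S : List ℕ → R) (hS : ∀ w w' : List ℕ, w.Perm w' → S w = S w')
    (U : List ℕ) {cs cs' : List Column} (h : cs'.Perm cs) : specL S U cs' = specL S U cs := by
  obtain ⟨e, he⟩ := exists_equiv_get_of_perm h
  exact specL_reindex S hS U cs cs' e he

end Reindex

/-! ## §2 Canonical order inside blocks of equal columns -/

section Canon

/-- Strict lexicographic comparison of variable lists (any fixed total preorder would do).
[folklore] -/
def lexLt : List ℕ → List ℕ → Bool
  | [], [] => false
  | [], _ :: _ => true
  | _ :: _, [] => false
  | a :: l, b :: l' => a < b || (a == b && lexLt l l')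

/-- Insert a (column, unused variables) pair in front of a list, letting it sink past pairs with the
SAME column and a smaller variable list. [folklore] -/
def insertP (p : Column × List ℕ) : List (Column × List ℕ) → List (Column × List ℕ)
  | [] => [p]
  | q :: l => if p.1 = q.1 ∧ lexLt q.2 p.2 = true then q :: insertP p l else p :: q :: l

/-- Insertion sort inside the blocks of equal adjacent columns. [folklore] -/
def isortP : List (Column × List ℕ) → List (Column × List ℕ)
  | [] => []
  | p :: l => insertP p (isortP l)

/-- **Canonical form of a state**: the lists of unused variables sorted inside every block of equal
adjacent columns (the columns themselves are not moved). [folklore] -/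
def canonSt (cols : List Column) (st : List (List ℕ)) : List (List ℕ) :=
  (isortP (List.zip cols st)).map Prod.snd

/-- Insertion permutes. [folklore] -/
private theorem insertP_perm (p : Column × List ℕ) : ∀ l, (insertP p l).Perm (p :: l)
  | [] => List.Perm.refl _
  | q :: l => by
    rw [insertP]
    split_ifs
    · exact ((insertP_perm p l).cons q).trans (List.Perm.swap p q l)
    · exact List.Perm.refl _

/-- Sorting permutes. [folklore] -/
private theorem isortP_perm : ∀ l : List (Column × List ℕ), (isortP l).Perm l
  | [] => List.Perm.refl _
  | p :: l => by rw [isortP]; exact (insertP_perm p _).trans ((isortP_perm l).cons p)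

/-- Insertion does not move the columns. [folklore] -/
private theorem map_fst_insertP (p : Column × List ℕ) :
    ∀ l, (insertP p l).map Prod.fst = p.1 :: l.map Prod.fst
  | [] => rfl
  | q :: l => by
    rw [insertP]
    split_ifs with h
    · rw [List.map_cons, map_fst_insertP p l, List.map_cons, h.1]
    · rfl

/-- Sorting does not move the columns. [folklore] -/
private theorem map_fst_isortP : ∀ l : List (Column × List ℕ), (isortP l).map Prod.fst = l.map Prod.fst
  | [] => rfl
  | p :: l => by rw [isortP, map_fst_insertP, map_fst_isortP l, List.map_cons]

/-- A list of pairs is the zip of its projections. [folklore] -/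
private theorem zip_map_fst_map_snd {α β : Type*} : ∀ l : List (α × β), List.zip (l.map Prod.fst) (l.map Prod.snd) = l
  | [] => rfl
  | p :: l => by simp [zip_map_fst_map_snd l]

/-- The canonical form keeps the length. [folklore] -/
private theorem length_canonSt (cols : List Column) (st : List (List ℕ)) (h : st.length = cols.length) :
    (canonSt cols st).length = cols.length := by
  rw [canonSt, List.length_map, (isortP_perm _).length_eq, List.length_zip, h, min_self]

/-- `resid` through `zip`. [folklore] -/
private theorem resid_eq_map_zip (cols : List Column) (st : List (List ℕ)) (u : ℕ) :
    resid cols st u = (List.zip cols st).map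
      fun pr => (⟨pr.2, pr.1.labels.filter fun l => decide (u ≤ l)⟩ : Column) := by
  unfold resid
  induction cols generalizing st with
  | nil => simp
  | cons c cs ih => cases st with
    | nil => simp
    | cons vs st => simp [ih]

/-- **The residual columns of the canonical form are a permutation of the residual columns.**
[cite: DorflerIkenmeyerPanova2020, §5 (proof of Prop. 5.1, arXiv pp. 12–13)] -/
theorem resid_canonSt_perm (cols : List Column) (st : List (List ℕ)) (h : st.length = cols.length) (u : ℕ) :
    (resid cols (canonSt cols st) u).Perm (resid cols st u) := by
  rw [resid_eq_map_zip, resid_eq_map_zip]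
  have hf : (isortP (List.zip cols st)).map Prod.fst = cols := by
    rw [map_fst_isortP, List.map_fst_zip]; rw [h]
  have hz : List.zip cols (canonSt cols st) = isortP (List.zip cols st) := by
    conv_lhs => arg 1; rw [← hf]
    rw [canonSt, zip_map_fst_map_snd]
  rw [hz]
  exact (isortP_perm _).map _

end Canon

/-! ## §3 The symmetrised programme and its meaning -/

section Program

variable {R : Type*} [CommRing R]

/-- Canonicalise the state of a layer entry (and recompute its key). [folklore] -/
def canonE (cols : List Column) (V : ℕ) (e : ℕ × List (List ℕ) × R) : ℕ × List (List ℕ) × R :=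
  (keyOf V (canonSt cols e.2.1), canonSt cols e.2.1, e.2.2)

/-- **One symmetrised layer**: the tree's `stepA`, then canonical states, re-sorted and merged.
[folklore] -/
def stepS (cols : List Column) (V : ℕ) (T : PTrie R) (u : ℕ) (L : List (ℕ × List (List ℕ) × R)) :
    List (ℕ × List (List ℕ) × R) :=
  let X := (stepA cols V T u L).map (canonE cols V)
  compressA (msortK (Nat.log2 X.length + 2) X)

/-- All symmetrised layers along a list of labels. [folklore] -/
def layersS (cols : List Column) (V : ℕ) (T : PTrie R) :
    List ℕ → List (ℕ × List (List ℕ) × R) → List (ℕ × List (List ℕ) × R)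
  | [], L => L
  | u :: us, L => layersS cols V T us (stepS cols V T u L)

/-- Concatenated label lists run the symmetrised layers in sequence. [cite: DorflerIkenmeyerPanova2020, §5 (proof of Prop. 5.1, arXiv pp. 12–13)] -/
theorem layersS_append (cols : List Column) (V : ℕ) (T : PTrie R) :
    ∀ (us us' : List ℕ) (L : List (ℕ × List (List ℕ) × R)),
      layersS cols V T (us ++ us') L = layersS cols V T us' (layersS cols V T us L)
  | [], _, _ => rfl
  | u :: us, us', L => by
    rw [List.cons_append, layersS, layersS]
    exact layersS_append cols V T us us' _

/-- States produced by `compressA` occur in its input. [folklore] -/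
private theorem exists_mem_of_mem_compressA : ∀ (l : List (ℕ × List (List ℕ) × R)) (x : ℕ × List (List ℕ) × R),
    x ∈ compressA l → ∃ y ∈ l, x.2.1 = y.2.1
  | [], x, hx => by simp [compressA] at hx
  | a :: l, x, hx => by
    change x ∈ pushA a (compressA l) at hx
    cases hc : compressA l with
    | nil => rw [hc, pushA] at hx; simp at hx; exact ⟨a, by simp, by rw [hx]⟩
    | cons b l' =>
      rw [hc, pushA] at hx
      split_ifs at hx with h
      · rcases List.mem_cons.mp hx with hx | hx
        · exact ⟨a, List.mem_cons_self, by rw [hx]⟩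
        · obtain ⟨y, hy, e⟩ := exists_mem_of_mem_compressA l x (by rw [hc]; exact List.mem_cons_of_mem _ hx)
          exact ⟨y, List.mem_cons_of_mem _ hy, e⟩
      · rcases List.mem_cons.mp hx with hx | hx
        · exact ⟨a, List.mem_cons_self, by rw [hx]⟩
        · obtain ⟨y, hy, e⟩ := exists_mem_of_mem_compressA l x (by rw [hc]; exact hx)
          exact ⟨y, List.mem_cons_of_mem _ hy, e⟩

/-- States in a symmetrised layer keep the length of the column list. [folklore] -/
private theorem length_of_mem_stepS (V : ℕ) (T : PTrie R) (cols : List Column) (u : ℕ)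
    (L : List (ℕ × List (List ℕ) × R)) (hL : ∀ e ∈ L, e.2.1.length = cols.length)
    (e : ℕ × List (List ℕ) × R) (he : e ∈ stepS cols V T u L) : e.2.1.length = cols.length := by
  unfold stepS at he
  obtain ⟨y, hy, hxy⟩ := exists_mem_of_mem_compressA _ e he
  rw [(msortK_perm _ _).mem_iff, List.mem_map] at hy
  obtain ⟨e0, he0, rfl⟩ := hy
  rw [hxy]
  exact length_canonSt _ _ (length_of_mem_stepA V T cols u L hL e0 he0)

/-- **One symmetrised layer step preserves the meaning**, for a content-blind entry function.
[cite: DorflerIkenmeyerPanova2020, §5 (proof of Prop. 5.1, arXiv pp. 12–13)] -/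
theorem layerSpec_stepS (V : ℕ) (T : PTrie R) (hT : ∀ w w' : List ℕ, w.Perm w' → T.find w = T.find w')
    (cols : List Column) (hcs : ∀ c ∈ cols, c.labels.Pairwise (· < ·)) (u n : ℕ)
    (L : List (ℕ × List (List ℕ) × R)) (hL : ∀ e ∈ L, e.2.1.length = cols.length) :
    layerSpec (fun w => T.find w) cols (u + 1) n (stepS cols V T u L) =
      layerSpec (fun w => T.find w) cols u (n + 1) L := by
  rw [← layerSpec_stepA V T cols hcs u n L hL]
  unfold stepS layerSpec
  refine Eq.trans (sum_compressA (fun st => specL (fun w => T.find w)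
    (List.range' (u + 1) n) (resid cols st (u + 1))) _) ?_
  rw [((msortK_perm _ _).map _).sum_eq, List.map_map]
  congr 1
  refine List.map_congr_left fun e he => ?_
  simp only [Function.comp_apply, canonE]
  rw [specL_perm (fun w => T.find w) hT _ (resid_canonSt_perm cols e.2.1
    (length_of_mem_stepA V T cols u L hL e he) (u + 1))]

/-- **The symmetrised layers compute the meaning.** [cite: DorflerIkenmeyerPanova2020, §5 (proof of Prop. 5.1, arXiv pp. 12–13)] -/
theorem layerSum_layersS (V : ℕ) (T : PTrie R) (hT : ∀ w w' : List ℕ, w.Perm w' → T.find w = T.find w')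
    (cols : List Column) (hcs : ∀ c ∈ cols, c.labels.Pairwise (· < ·)) :
    ∀ (n u : ℕ) (L : List (ℕ × List (List ℕ) × R)), (∀ e ∈ L, e.2.1.length = cols.length) →
      layerSum (layersS cols V T (List.range' u n) L) = layerSpec (fun w => T.find w) cols u n L
  | 0, u, L, _ => by
    simp [layersS, layerSum, layerSpec, specL]
  | n + 1, u, L, hL => by
    rw [List.range'_succ, layersS, layerSum_layersS V T hT cols hcs n (u + 1) _
      (length_of_mem_stepS V T cols u L hL), layerSpec_stepS V T hT cols hcs u n L hL]

end Program

/-! ## §4 The table trie is content-blind; `evalTS = evalT` -/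

section Trie

variable {R : Type*} [CommRing R] [DecidableEq R]

/-- **Table-driven, column-symmetrised label-major evaluation** of a tableau network. [folklore] -/
def evalTS (tab : List (List ℕ × R)) (Nw : Network) : R :=
  layerSum (layersS Nw.cols Nw.varBound (tableTrie Nw.varBound tab Nw.perLabel [])
    (List.range Nw.nlabels) Nw.initLayer)

/-- Total description of the table trie's lookup: the table value at the content of `pre ++ w` on
words of the right length with letters `< V`, zero elsewhere. [cite: DorflerIkenmeyerPanova2020, §5 (proof of Prop. 5.1, arXiv pp. 12–13)] -/
theorem find_tableTrie_total (V : ℕ) (tab : List (List ℕ × R)) : ∀ (k : ℕ) (pre w : List ℕ),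
    (tableTrie V tab k pre).find w =
      if w.length = k ∧ (∀ v ∈ w, v < V) then lookupC tab (counts V (pre ++ w)) else 0
  | 0, pre, w => by
    rw [tableTrie, PTrie.mkLeaf]
    cases w with
    | nil =>
      simp only [List.length_nil, List.not_mem_nil, IsEmpty.forall_iff, implies_true, and_self,
        ↓reduceIte, List.append_nil]
      split_ifs with h
      · rw [PTrie.find_empty, h]
      · rfl
    | cons v w =>
      have hne : ¬ ((v :: w).length = 0 ∧ ∀ x ∈ v :: w, x < V) := by simp
      rw [if_neg hne]
      split_ifs
      · exact PTrie.find_empty _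
      · rfl
  | k + 1, pre, w => by
    rw [tableTrie, PTrie.mkNode]
    cases w with
    | nil =>
      have hne : ¬ (([] : List ℕ).length = k + 1 ∧ ∀ x ∈ ([] : List ℕ), x < V) := by simp
      rw [if_neg hne]
      split_ifs
      · exact PTrie.find_empty _
      · exact PTrie.find_nil _
    | cons v w =>
      have IH := find_tableTrie_total V tab k (pre ++ [v]) w
      rw [List.append_assoc, List.singleton_append] at IH
      -- the child `v`
      have hchild : ∀ ts : List (PTrie R), ts = (List.range V).map (fun i => tableTrie V tab k (pre ++ [i])) →
          (PTrie.node ts).find (v :: w) = if v < V then (tableTrie V tab k (pre ++ [v])).find w else 0 := by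
        intro ts hts
        rw [PTrie.find_cons, PTrie.child, hts]
        split_ifs with hv
        · rw [List.getD_eq_getElem _ _ (by simpa using hv)]; simp
        · rw [List.getD_eq_default _ _ (by simpa using hv), PTrie.find_empty]
      split_ifs with hall hcond hcond
      · -- all children empty: the value below `v` is zero
        rw [PTrie.find_empty]
        obtain ⟨hlen, hlt⟩ := hcond
        have hv : v < V := hlt v List.mem_cons_self
        have hempty : tableTrie V tab k (pre ++ [v]) = PTrie.empty := by
          rw [List.all_eq_true] at hall
          exact (PTrie.isEmpty_iff _).mp (hall _ (List.mem_map.mpr ⟨v, List.mem_range.mpr hv, rfl⟩))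
        have := IH
        rw [hempty, PTrie.find_empty, if_pos ⟨by simpa using hlen, fun x hx => hlt x (List.mem_cons_of_mem _ hx)⟩] at this
        exact this
      · rw [PTrie.find_empty]
      · rw [hchild _ rfl, if_pos (hcond.2 v List.mem_cons_self), IH,
          if_pos ⟨by simpa using hcond.1, fun x hx => hcond.2 x (List.mem_cons_of_mem _ hx)⟩]
      · rw [hchild _ rfl]
        split_ifs with hv
        · rw [IH, if_neg]
          rintro ⟨hlen, hlt⟩
          exact hcond ⟨by simpa using hlen, fun x hx => by
            rcases List.mem_cons.mp hx with rfl | hx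
            · exact hv
            · exact hlt x hx⟩
        · rfl

/-- The count vector is blind to the order of the word. [folklore] -/
private theorem counts_perm (V : ℕ) {w w' : List ℕ} (h : w.Perm w') : counts V w = counts V w' := by
  unfold counts
  exact List.map_congr_left fun v _ => h.count_eq v

/-- **The table trie's lookup is content-blind.** [cite: DorflerIkenmeyerPanova2020, §5 (proof of Prop. 5.1, arXiv pp. 12–13)] -/
theorem find_tableTrie_perm (V m : ℕ) (tab : List (List ℕ × R)) {w w' : List ℕ} (h : w.Perm w') :
    (tableTrie V tab m []).find w = (tableTrie V tab m []).find w' := by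
  rw [find_tableTrie_total, find_tableTrie_total, List.nil_append, List.nil_append, counts_perm V h,
    h.length_eq]
  have hiff : (∀ v ∈ w, v < V) ↔ (∀ v ∈ w', v < V) := ⟨fun H v hv => H v (h.symm.subset hv),
    fun H v hv => H v (h.subset hv)⟩
  simp only [hiff]

/-- **The symmetrised programme computes the same number as `evalT`** (column-strict networks).
[cite: DorflerIkenmeyerPanova2020, §5 (proof of Prop. 5.1, arXiv pp. 12–13)] -/
theorem evalTS_eq_evalT (tab : List (List ℕ × R)) (Nw : Network) (hcs : Nw.columnStrict = true) :
    evalTS tab Nw = evalT tab Nw := by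
  unfold evalTS evalT
  have h0 : ∀ e ∈ (Nw.initLayer : List (ℕ × List (List ℕ) × R)), e.2.1.length = Nw.cols.length := by
    intro e he; simp [Network.initLayer] at he; subst he; simp
  rw [List.range_eq_range', layerSum_layersS Nw.varBound _ (fun w w' h => find_tableTrie_perm _ _ _ h)
      Nw.cols (pairwise_of_columnStrict Nw hcs) Nw.nlabels 0 _ h0,
    layerSum_layersA Nw.varBound _ Nw.cols (pairwise_of_columnStrict Nw hcs) Nw.nlabels 0 _ h0]

/-- **Splitting the symmetrised evaluation at label `k`** (several kernel chunks per certificate).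
[cite: DorflerIkenmeyerPanova2020, §5 (proof of Prop. 5.1, arXiv pp. 12–13)] -/
theorem evalTS_eq_layerSum_split (tab : List (List ℕ × R)) (Nw : Network) (k : ℕ) (hk : k ≤ Nw.nlabels) :
    evalTS tab Nw =
      layerSum (layersS Nw.cols Nw.varBound (tableTrie Nw.varBound tab Nw.perLabel [])
        (List.range' k (Nw.nlabels - k))
        (layersS Nw.cols Nw.varBound (tableTrie Nw.varBound tab Nw.perLabel [])
          (List.range' 0 k) Nw.initLayer)) := by
  unfold evalTS
  rw [← layersS_append, List.range_eq_range']
  congr 2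
  rw [show List.range' k (Nw.nlabels - k) = List.range' (0 + k) (Nw.nlabels - k) by rw [Nat.zero_add],
    List.range'_append_1]
  congr 1
  omega

end Trie

/-! ## §5 The one-entry certificate theorem with the symmetrised evaluator -/

section Certificate

open _root_.Literature.NumberTheory.DiophantineGeometry

/-- **One-entry positivity certificate at a Chow point, symmetrised evaluator**: as
`coordRingMultiplicity_chowSet_pos_of_tableCertificate` with `evalTS` in place of `evalT`.
[cite: DorflerIkenmeyerPanova2020, Prop. 5.1 and §5 (arXiv p. 12)] -/
theorem coordRingMultiplicity_chowSet_pos_of_tableCertificateS (K : Type) [Field K] [CharZero K]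
    {N : ℕ} [NeZero N] {m e : ℕ} (hm : m ≠ 0) (lam : Nat.Partition e) (lamL : List ℕ)
    (hlamL : lam.sortedParts = lamL) (hlen : lamL.length ≤ N)
    (Nw : Network) (rows : List (List ℤ)) (tab : List (List ℕ × ℤ))
    (hnet : Nw.check = true ∧ Nw.canonicalVars = true ∧ Nw.columnStrict = true ∧ Nw.perLabel = m ∧
      Nw.shape = lamL)
    (hrows : rows.length = m) (htab : checkTable (chowPoint rows) Nw.varBound m tab = true)
    (v : ℤ) (hval : evalTS tab Nw = v) (hv : v ≠ 0) :
    0 < coordRingMultiplicity K (chowSet K N m) m (Weight.dualOfPartition N lam) :=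
  coordRingMultiplicity_chowSet_pos_of_tableCertificate K hm lam lamL hlamL hlen Nw rows tab hnet hrows
    htab v (by rw [← evalTS_eq_evalT tab Nw hnet.2.2.1]; exact hval) hv

end Certificate

/-! ## §6 Sanity values (kernel) -/

/-- On the `1 1 / 2 2` toy network (two equal columns) at the table of `2 x₀ x₁`:
`evalTS = evalT = -8`. [folklore] -/
example :
    let N : Network := ⟨2, 2, [⟨[0, 1], [0, 1]⟩, ⟨[0, 1], [0, 1]⟩]⟩
    evalTS ([([1, 1], (2 : ℤ))]) N = -8 ∧ evalT ([([1, 1], (2 : ℤ))]) N = -8 := by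
  decide +kernel

/-- The motivating residue row of DIP Prop. 5.1's `Ch_4^7` half: shape `(10,6,6,6)`, `d = 4`, whose
ONLY column-strict filling has six equal full columns. At the sparse integer Chow point
`x · x · z · w · (2w - x) · (2y + 2z) · (y - z)` the symmetrised programme needs `≈ 1.2·10⁴` transitions
(`4 / 37 / 8 / 1` canonical states after the four labels) where `evalT` needs `≈ 1.1·10⁶`
(`480 / 5600 / 640 / 1` states); the value is `91729428480 ≠ 0`. [folklore] -/
example :
    let N : Network := ⟨4, 7, [⟨[0, 1, 2, 3], [0, 1, 2, 3]⟩, ⟨[0, 1, 2, 3], [0, 1, 2, 3]⟩,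
      ⟨[0, 1, 2, 3], [0, 1, 2, 3]⟩, ⟨[0, 1, 2, 3], [0, 1, 2, 3]⟩, ⟨[0, 1, 2, 3], [0, 1, 2, 3]⟩,
      ⟨[0, 1, 2, 3], [0, 1, 2, 3]⟩, ⟨[0], [0]⟩, ⟨[0], [1]⟩, ⟨[0], [2]⟩, ⟨[0], [3]⟩]⟩
    let tab : List (List ℕ × ℤ) :=
      [([2, 0, 3, 2], -96), ([2, 2, 1, 2], 32), ([3, 0, 3, 1], 72), ([3, 2, 1, 1], -24)]
    evalTS tab N = 91729428480 := by
  decide +kernel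

end TableauEval

end Literature.Computability.AlgebraicComplexity
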